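import Literature.NumberTheory.Weil1964.ArchSchrodingerFollandDictionary
import Literature.NumberTheory.Weil1964.AdelicMetaplecticContinuous
import HarnessLib

/-!
# Archimedean implementers give elements of the adelic metaplectic group: `(g_∞, 1) ↦ (A ⊗ 1) ∈ Mp_ψ(W_𝔸)ᶜᵒⁿᵗ`

Topic `NumberTheory/Weil1964`; namespace `Literature.NumberTheory.Weil1964`.  KERNEL ONLY: theorems and one
definition with body (`tensorEndEquiv`, the linear automorphism `A ⊗ 1`); no record, no hypothesis, no `sorry`.

THE CONVERSE of `ArchSchrodingerFollandDictionary.arch_covariant_of_implements`.  Let `g ∈ Sp(W_𝔸)`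
(`W_𝔸 = 𝔸_F^ι × 𝔸_F^ι`, polarised form `β_T`) FIX THE FINITE VECTORS (`g (0, k) = (0, k)` componentwise: `g` is
"archimedean", `g = (g_∞, 1)`), and let `A` be a topological automorphism of `𝓢((F ⊗ ℝ)^ι)` which is covariant over
the archimedean modulated translations up to Weil's phase,
`A (archModTrans T a w Φ) = ψ_F(f_g(V)) • archModTrans T a' w' (A Φ)`, `(a', w') = archAct g (a, w)` — exactly
the conclusion of `arch_covariant_of_implements`.  THEN `(g, A ⊗ 1)` is an element of `Mp_ψ(W_𝔸)`
(`tensorEnd_mem_adelicMp`: condition (A) of [MoeglinVignerasWaldspurger1987, Chap. 2 II.1] for the global Schrödinger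
representation), and of the metaplectic group OF RECORD `Mp_ψ(W_𝔸)ᶜᵒⁿᵗ` (`tensorEnd_mem_adelicMpCont`).  This is
Weil's factorisation `𝐫_𝐀(s_∞, 1) = 𝐫_∞(s_∞) ⊗ 1` [Weil1964, Chap. III n° 37–38] read as a CONSTRUCTION of adelic
implementers from archimedean ones — the form in which an archimedean Weil representation (e.g. of
`U(J)(F ⊗ ℝ)`) is turned into a homomorphism into `Mp_ψ(W_𝔸)ᶜᵒⁿᵗ` by archimedean operators `A ⊗ 1`.

Ingredients (§1): the global Schrödinger operator of a GENERAL Heisenberg element on pure tensors,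
`ρ(⟨(x,y),t⟩)(Φ_∞ ⊗ f) = ψ_F(t) • (archModTrans T x_∞ y_∞ Φ_∞) ⊗ (ψ_f(⟨·,(Ty)_f⟩) f(· + x_f))`
(`adelicSchrodinger_mk_tmul`, extending the tree's archimedean case `adelicSchrodinger_mk_archVec_tmul`); (§2) an
archimedean `g` acts on `(x, y)` through `archAct g` on the archimedean parts and trivially on the finite parts, and
Weil's quadratic character `f_g(x, y)` only sees the archimedean parts (`arch_f_apply_eq_f_archVec`).

## References

* [Weil1964] A. Weil, *Sur certains groupes d'opérateurs unitaires*, Acta Math. 111 (1964), Chap. I n° 4–5 pp. 149–151,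
  Chap. III n° 37–38 pp. 188–190.
* [MoeglinVignerasWaldspurger1987] C. Mœglin, M.-F. Vignéras, J.-L. Waldspurger, LNM 1291 (1987), Chap. 2 II.1 (A).
* [GelbartRogawski1991] S. Gelbart, J. Rogawski, Invent. math. 105 (1991), §3.1 p. 454 (the pairs `(g, M_g)`).
-/

set_option autoImplicit false

noncomputable section

open scoped Matrix SchwartzMap TensorProduct Classical
open Complex NumberField NumberField.mixedEmbedding IsDedekindDomain
open Literature.NumberTheory.Automorphic Literature.RepresentationTheory.HeisenbergGroup
open Literature.Analysis.SegalBargmann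

namespace Literature.NumberTheory.Weil1964

variable {F : Type} [Field F] [NumberField F] {ι : Type} [Fintype ι] [DecidableEq ι]
  (T : Matrix ι ι (AdeleRing (𝓞 F) F))

/-! ## 1. The global Schrödinger operators on pure tensors -/

/-- the finite vector `(0, k) ∈ 𝔸_F^ι`. [cite: Weil1964, Chap. III n° 37 p. 188] -/
abbrev finVec (k : ι → FiniteAdeleRing (𝓞 F) F) : ι → AdeleRing (𝓞 F) F := piAdeleSplit F ι (0, k)

omit [Fintype ι] [DecidableEq ι] in
/-- `piArch (0, k) = 0`. [cite: Weil1964, Chap. III n° 37 p. 188] -/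
@[simp] theorem piArch_finVec (k : ι → FiniteAdeleRing (𝓞 F) F) : piArch F ι (finVec k) = 0 :=
  piArch_piAdeleSplit (0, k)

omit [Fintype ι] [DecidableEq ι] in
/-- `piFinite (0, k) = k`. [cite: Weil1964, Chap. III n° 37 p. 188] -/
@[simp] theorem piFinite_finVec (k : ι → FiniteAdeleRing (𝓞 F) F) : piFinite F ι (finVec k) = k :=
  piFinite_piAdeleSplit (0, k)

omit [Fintype ι] [DecidableEq ι] in
/-- **every adelic vector is archimedean part plus finite part**: `v = archVec v_∞ + (0, v_f)`.
[cite: Weil1964, Chap. III n° 37 p. 188] -/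
theorem eq_archVec_add_finVec (v : ι → AdeleRing (𝓞 F) F) :
    v = archVec F ι (piArch F ι v) + finVec (piFinite F ι v) := by
  conv_lhs => rw [eq_piAdeleSplit F ι v]
  rw [archVec, ← map_add, Prod.mk_add_mk, add_zero, zero_add]

omit [DecidableEq ι] in
/-- `(T v)_∞ = T_∞ v_∞`: an adelic matrix acts on archimedean parts through its archimedean part.
[cite: Weil1964, Chap. III n° 37 p. 188] -/
theorem piArch_mulVec (v : ι → AdeleRing (𝓞 F) F) : piArch F ι (T *ᵥ v) = archMat F ι T *ᵥ piArch F ι v := by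
  funext i
  rw [piArch_apply, Matrix.mulVec, dotProduct, AdeleRing.fst_sum, map_sum, Matrix.mulVec, dotProduct]
  refine Finset.sum_congr rfl fun j _ => ?_
  rw [show (T i j * v j).1 = (T i j).1 * (v j).1 from rfl, map_mul, archMat, piArch_apply]

omit [DecidableEq ι] in
/-- `(T (0, k))_∞ = 0`. [cite: Weil1964, Chap. III n° 37 p. 188] -/
theorem piArch_mulVec_finVec (k : ι → FiniteAdeleRing (𝓞 F) F) : piArch F ι (T *ᵥ finVec k) = 0 := by
  rw [piArch_mulVec, piArch_finVec, Matrix.mulVec_zero]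

omit [DecidableEq ι] in
/-- `(T archVec a)_f = 0`. [cite: Weil1964, Chap. III n° 37 p. 188] -/
theorem piFinite_mulVec_archVec (a : ι → mixedSpace F) : piFinite F ι (T *ᵥ archVec F ι a) = 0 := by
  rw [mulVec_archVec, piFinite_archVec]

omit [DecidableEq ι] in
/-- `(T v)_f = (T (0, v_f))_f`. [cite: Weil1964, Chap. III n° 37 p. 188] -/
theorem piFinite_mulVec (v : ι → AdeleRing (𝓞 F) F) :
    piFinite F ι (T *ᵥ v) = piFinite F ι (T *ᵥ finVec (piFinite F ι v)) := by
  conv_lhs => rw [eq_archVec_add_finVec v, Matrix.mulVec_add, piFinite_add, piFinite_mulVec_archVec, zero_add]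

omit [Fintype ι] [DecidableEq ι] in
/-- **archimedean ⊥ finite**: `archVec a ⬝ᵥ (0, k) = 0`. [cite: Weil1964, Chap. III n° 38 p. 189] -/
theorem archVec_dotProduct_of_piArch_eq_zero [Fintype ι] (a : ι → mixedSpace F) {v : ι → AdeleRing (𝓞 F) F}
    (hv : piArch F ι v = 0) : archVec F ι a ⬝ᵥ v = 0 := by
  rw [dotProduct]
  refine Finset.sum_eq_zero fun i _ => Prod.ext ?_ ?_
  · have hi : (v i).1 = 0 := by
      have h := congrFun hv i
      rw [piArch_apply, Pi.zero_apply] at h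
      simpa using (InfiniteAdeleRing.ringEquiv_mixedSpace F).injective (h.trans (map_zero _).symm)
    show (archVec F ι a i).1 * (v i).1 = 0
    rw [hi, mul_zero]
  · show (archVec F ι a i).2 * (v i).2 = 0
    rw [archVec_apply_snd, zero_mul]

omit [Fintype ι] [DecidableEq ι] in
/-- `(0, k) ⬝ᵥ archVec a = 0`-type: `v ⬝ᵥ w = 0` when `v_∞ = 0` and `w_f = 0`. [cite: Weil1964, Chap. III n° 38 p. 189] -/
theorem dotProduct_eq_zero_of_parts [Fintype ι] {v w : ι → AdeleRing (𝓞 F) F} (hv : piArch F ι v = 0)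
    (hw : piFinite F ι w = 0) : v ⬝ᵥ w = 0 := by
  rw [dotProduct]
  refine Finset.sum_eq_zero fun i _ => Prod.ext ?_ ?_
  · have hi : (v i).1 = 0 := by
      have h := congrFun hv i
      rw [piArch_apply, Pi.zero_apply] at h
      simpa using (InfiniteAdeleRing.ringEquiv_mixedSpace F).injective (h.trans (map_zero _).symm)
    show (v i).1 * (w i).1 = 0
    rw [hi, zero_mul]
  · have hi : (w i).2 = 0 := congrFun hw i
    show (v i).2 * (w i).2 = 0
    rw [hi, mul_zero]

/-- **The global Schrödinger operator of a general Heisenberg element on a pure tensor**: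
`ρ(⟨(x,y),t⟩)(Φ_∞ ⊗ f) = ψ_F(t) • (archModTrans T x_∞ y_∞ Φ_∞) ⊗ (ψ_f(⟨·, (Ty)_f⟩) · f(x_f + ·))`.
[cite: MoeglinVignerasWaldspurger1987, Chap. 2 I.4 Exemple (1); Weil1964, Chap. III n° 38 p. 189] -/
theorem adelicSchrodinger_mk_tmul (x y : ι → AdeleRing (𝓞 F) F) (t : AdeleRing (𝓞 F) F)
    (Φ : 𝓢((ι → mixedSpace F), ℂ)) (f : FinSB F ι) :
    adelicSchrodinger F ι T (⟨(x, y), t⟩ : AdelicHeisenberg F ι T) (piSchwartzBruhatEquiv F ι (Φ ⊗ₜ f)) =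
      ((adeleAddChar F t : Circle) : ℂ) •
        piSchwartzBruhatEquiv F ι (archModTrans F ι T (piArch F ι x) (piArch F ι y) Φ ⊗ₜ
          finModulateSB F ι (piFinite F ι (T *ᵥ y)) (finTranslateSB F ι (piFinite F ι x) f)) := by
  apply Subtype.ext
  rw [Submodule.coe_smul, coe_piSchwartzBruhatEquiv_tmul]
  funext u
  rw [adelicSchrodinger_apply, coe_piSchwartzBruhatEquiv_tmul, Pi.smul_apply, smul_eq_mul, AddChar.map_add_eq_mul,
    Circle.coe_mul, ← linChar_apply, linChar_eq_mul, piArch_mulVec]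
  simp only [archModTrans_apply, coe_finModulateSB_apply, coe_finTranslateSB_apply, finLinChar_apply, piArch_add,
    piFinite_add]
  rw [add_comm (piFinite F ι u) (piFinite F ι x)]
  ring

/-! ## 2. Archimedean symplectic elements: action and Weil character on general vectors -/

section Arch

variable (g : symplecticGroup (polar (adelicForm F ι T)))

variable {T g}

/-! An element `g ∈ Sp(W_𝔸)` is ARCHIMEDEAN when it fixes the finite vectors `((0, k), (0, c))`; this hypothesis is
spelled out as `hg : ∀ k c, g (finVec k, finVec c) = (finVec k, finVec c)` below (no `Prop`-valued definition). -/

/-- **An archimedean `g` acts on `(x, y)` through `archAct g` on the archimedean parts and trivially on the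
finite parts.** [cite: Weil1964, Chap. III n° 37–38 pp. 188–189] -/
theorem arch_apply_eq (hg : ∀ k c : ι → FiniteAdeleRing (𝓞 F) F, g.1 (finVec k, finVec c) = (finVec k, finVec c)) (x y : ι → AdeleRing (𝓞 F) F) :
    g.1 (x, y) =
      (archVec F ι (archAct T g (piArch F ι x, piArch F ι y)).1 + finVec (piFinite F ι x),
        archVec F ι (archAct T g (piArch F ι x, piArch F ι y)).2 + finVec (piFinite F ι y)) := by
  have hsplit : (x, y) = (archVec F ι (piArch F ι x), archVec F ι (piArch F ι y)) +
      (finVec (piFinite F ι x), finVec (piFinite F ι y)) := by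
    rw [Prod.mk_add_mk, ← eq_archVec_add_finVec, ← eq_archVec_add_finVec]
  rw [hsplit, map_add, apply_archVec_pair, hg, Prod.mk_add_mk]

/-- archimedean part of the first component of `g (x, y)`. [cite: Weil1964, Chap. III n° 38 p. 189] -/
theorem arch_piArch_apply_fst (hg : ∀ k c : ι → FiniteAdeleRing (𝓞 F) F, g.1 (finVec k, finVec c) = (finVec k, finVec c)) (x y : ι → AdeleRing (𝓞 F) F) :
    piArch F ι (g.1 (x, y)).1 = (archAct T g (piArch F ι x, piArch F ι y)).1 := by
  rw [(arch_apply_eq hg), piArch_add, piArch_archVec, piArch_finVec, add_zero]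

/-- archimedean part of the second component of `g (x, y)`. [cite: Weil1964, Chap. III n° 38 p. 189] -/
theorem arch_piArch_apply_snd (hg : ∀ k c : ι → FiniteAdeleRing (𝓞 F) F, g.1 (finVec k, finVec c) = (finVec k, finVec c)) (x y : ι → AdeleRing (𝓞 F) F) :
    piArch F ι (g.1 (x, y)).2 = (archAct T g (piArch F ι x, piArch F ι y)).2 := by
  rw [(arch_apply_eq hg), piArch_add, piArch_archVec, piArch_finVec, add_zero]

/-- finite part of the first component of `g (x, y)`. [cite: Weil1964, Chap. III n° 38 p. 189] -/
theorem arch_piFinite_apply_fst (hg : ∀ k c : ι → FiniteAdeleRing (𝓞 F) F, g.1 (finVec k, finVec c) = (finVec k, finVec c)) (x y : ι → AdeleRing (𝓞 F) F) :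
    piFinite F ι (g.1 (x, y)).1 = piFinite F ι x := by
  rw [(arch_apply_eq hg), piFinite_add, piFinite_archVec, piFinite_finVec, zero_add]

/-- finite part of the second component of `g (x, y)`. [cite: Weil1964, Chap. III n° 38 p. 189] -/
theorem arch_piFinite_apply_snd (hg : ∀ k c : ι → FiniteAdeleRing (𝓞 F) F, g.1 (finVec k, finVec c) = (finVec k, finVec c)) (x y : ι → AdeleRing (𝓞 F) F) :
    piFinite F ι (g.1 (x, y)).2 = piFinite F ι y := by
  rw [(arch_apply_eq hg), piFinite_add, piFinite_archVec, piFinite_finVec, zero_add]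

/-- `(T (g(x,y)).2)_f = (T y)_f` for archimedean `g`. [cite: Weil1964, Chap. III n° 38 p. 189] -/
theorem arch_piFinite_mulVec_apply_snd (hg : ∀ k c : ι → FiniteAdeleRing (𝓞 F) F, g.1 (finVec k, finVec c) = (finVec k, finVec c)) (x y : ι → AdeleRing (𝓞 F) F) :
    piFinite F ι (T *ᵥ (g.1 (x, y)).2) = piFinite F ι (T *ᵥ y) := by
  rw [piFinite_mulVec, (arch_piFinite_apply_snd hg), ← piFinite_mulVec]

omit [DecidableEq ι] in
/-- the polarised form `x ⬝ᵥ T y` splits into archimedean and finite contributions: for `v = archVec a + (0,k)`,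
`w = archVec b + (0,c)`: `v ⬝ T w = archVec a ⬝ T archVec b + (0,k) ⬝ T (0,c)`. [cite: Weil1964, Chap. III n° 38 p. 189] -/
theorem dotProduct_mulVec_split (a b : ι → mixedSpace F) (k c : ι → FiniteAdeleRing (𝓞 F) F) :
    (archVec F ι a + finVec k) ⬝ᵥ (T *ᵥ (archVec F ι b + finVec c)) =
      archVec F ι a ⬝ᵥ (T *ᵥ archVec F ι b) + finVec k ⬝ᵥ (T *ᵥ finVec c) := by
  rw [Matrix.mulVec_add, add_dotProduct, dotProduct_add, dotProduct_add,
    archVec_dotProduct_of_piArch_eq_zero a (piArch_mulVec_finVec T c),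
    dotProduct_eq_zero_of_parts (piArch_finVec k) (piFinite_mulVec_archVec T b), add_zero, zero_add]

omit [DecidableEq ι] in
/-- `x ⬝ T y = archVec x_∞ ⬝ T archVec y_∞ + (0,x_f) ⬝ T (0,y_f)`. [cite: Weil1964, Chap. III n° 38 p. 189] -/
theorem dotProduct_mulVec_eq_split (x y : ι → AdeleRing (𝓞 F) F) :
    x ⬝ᵥ (T *ᵥ y) = archVec F ι (piArch F ι x) ⬝ᵥ (T *ᵥ archVec F ι (piArch F ι y)) +
      finVec (piFinite F ι x) ⬝ᵥ (T *ᵥ finVec (piFinite F ι y)) := by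
  conv_lhs => rw [eq_archVec_add_finVec x, eq_archVec_add_finVec y]
  exact dotProduct_mulVec_split _ _ _ _

/-- **Weil's quadratic character of an archimedean `g` only sees archimedean parts**:
`f_g(x, y) = f_g(archVec x_∞, archVec y_∞)`. [cite: Weil1964, Chap. I n° 5 pp. 150–151] -/
theorem arch_f_apply_eq_f_archVec (hg : ∀ k c : ι → FiniteAdeleRing (𝓞 F) F, g.1 (finVec k, finVec c) = (finVec k, finVec c)) (x y : ι → AdeleRing (𝓞 F) F) :
    (ofSymplectic (polar (adelicForm F ι T)) g).f (x, y) =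
      (ofSymplectic (polar (adelicForm F ι T)) g).f (archVec F ι (piArch F ι x), archVec F ι (piArch F ι y)) := by
  rw [ofSymplectic_f, ofSymplectic_f]
  congr 1
  rw [(arch_apply_eq hg), apply_archVec_pair]
  simp only [polar_apply, adelicForm_apply]
  rw [dotProduct_mulVec_split, dotProduct_mulVec_eq_split (T := T) x y]
  ring

/-- hence `ψ_F(f_g(x, y)) = weilPhase g (x_∞, y_∞)`. [cite: Weil1964, Chap. I n° 5 pp. 150–151] -/
theorem arch_addChar_f_apply (hg : ∀ k c : ι → FiniteAdeleRing (𝓞 F) F, g.1 (finVec k, finVec c) = (finVec k, finVec c)) (x y : ι → AdeleRing (𝓞 F) F) :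
    ((adeleAddChar F ((ofSymplectic (polar (adelicForm F ι T)) g).f (x, y)) : Circle) : ℂ) =
      weilPhase T g (piArch F ι x, piArch F ι y) := by
  rw [(arch_f_apply_eq_f_archVec hg), weilPhase]

end Arch

/-! ## 3. `A ⊗ 1` is an implementer -/

section Implementer

variable (A : 𝓢((ι → mixedSpace F), ℂ) ≃L[ℂ] 𝓢((ι → mixedSpace F), ℂ))

omit [DecidableEq ι] in
/-- `(A ⊗ 1) ∘ (A⁻¹ ⊗ 1) = 1`. [cite: Weil1964, Chap. III n° 38 p. 189] -/
private theorem tensorEnd_comp_symm :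
    (adelicTensorEnd ((A : 𝓢((ι → mixedSpace F), ℂ) →L[ℂ] 𝓢((ι → mixedSpace F), ℂ)) :
        𝓢((ι → mixedSpace F), ℂ) →ₗ[ℂ] 𝓢((ι → mixedSpace F), ℂ)) LinearMap.id).comp
      (adelicTensorEnd ((A.symm : 𝓢((ι → mixedSpace F), ℂ) →L[ℂ] 𝓢((ι → mixedSpace F), ℂ)) :
        𝓢((ι → mixedSpace F), ℂ) →ₗ[ℂ] 𝓢((ι → mixedSpace F), ℂ)) LinearMap.id) = LinearMap.id := by
  rw [← adelicTensorEnd_comp, LinearMap.id_comp]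
  have h : ((A : 𝓢((ι → mixedSpace F), ℂ) →L[ℂ] 𝓢((ι → mixedSpace F), ℂ)) :
      𝓢((ι → mixedSpace F), ℂ) →ₗ[ℂ] 𝓢((ι → mixedSpace F), ℂ)).comp
      ((A.symm : 𝓢((ι → mixedSpace F), ℂ) →L[ℂ] 𝓢((ι → mixedSpace F), ℂ)) :
        𝓢((ι → mixedSpace F), ℂ) →ₗ[ℂ] 𝓢((ι → mixedSpace F), ℂ)) = LinearMap.id :=
    LinearMap.ext fun Φ => A.apply_symm_apply Φ
  rw [h, adelicTensorEnd_id]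

omit [DecidableEq ι] in
/-- `(A⁻¹ ⊗ 1) ∘ (A ⊗ 1) = 1`. [cite: Weil1964, Chap. III n° 38 p. 189] -/
private theorem tensorEnd_symm_comp :
    (adelicTensorEnd ((A.symm : 𝓢((ι → mixedSpace F), ℂ) →L[ℂ] 𝓢((ι → mixedSpace F), ℂ)) :
        𝓢((ι → mixedSpace F), ℂ) →ₗ[ℂ] 𝓢((ι → mixedSpace F), ℂ)) LinearMap.id).comp
      (adelicTensorEnd ((A : 𝓢((ι → mixedSpace F), ℂ) →L[ℂ] 𝓢((ι → mixedSpace F), ℂ)) :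
        𝓢((ι → mixedSpace F), ℂ) →ₗ[ℂ] 𝓢((ι → mixedSpace F), ℂ)) LinearMap.id) = LinearMap.id := by
  rw [← adelicTensorEnd_comp, LinearMap.id_comp]
  have h : ((A.symm : 𝓢((ι → mixedSpace F), ℂ) →L[ℂ] 𝓢((ι → mixedSpace F), ℂ)) :
      𝓢((ι → mixedSpace F), ℂ) →ₗ[ℂ] 𝓢((ι → mixedSpace F), ℂ)).comp
      ((A : 𝓢((ι → mixedSpace F), ℂ) →L[ℂ] 𝓢((ι → mixedSpace F), ℂ)) :
        𝓢((ι → mixedSpace F), ℂ) →ₗ[ℂ] 𝓢((ι → mixedSpace F), ℂ)) = LinearMap.id :=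
    LinearMap.ext fun Φ => A.symm_apply_apply Φ
  rw [h, adelicTensorEnd_id]

omit [DecidableEq ι] in
/-- **`A ⊗ 1` as a linear automorphism of `𝒮(𝔸_F^ι)`** (inverse `A⁻¹ ⊗ 1`). [cite: Weil1964, Chap. III n° 38 p. 189] -/
def tensorEndEquiv : piSchwartzBruhat F ι ≃ₗ[ℂ] piSchwartzBruhat F ι :=
  LinearEquiv.ofLinear
    (adelicTensorEnd ((A : 𝓢((ι → mixedSpace F), ℂ) →L[ℂ] 𝓢((ι → mixedSpace F), ℂ)) :
      𝓢((ι → mixedSpace F), ℂ) →ₗ[ℂ] 𝓢((ι → mixedSpace F), ℂ)) LinearMap.id)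
    (adelicTensorEnd ((A.symm : 𝓢((ι → mixedSpace F), ℂ) →L[ℂ] 𝓢((ι → mixedSpace F), ℂ)) :
      𝓢((ι → mixedSpace F), ℂ) →ₗ[ℂ] 𝓢((ι → mixedSpace F), ℂ)) LinearMap.id)
    (tensorEnd_comp_symm A) (tensorEnd_symm_comp A)

omit [DecidableEq ι] in
/-- `tensorEndEquiv A` acts by `A ⊗ 1`. [cite: Weil1964, Chap. III n° 38 p. 189] -/
@[simp] theorem tensorEndEquiv_apply (Φ : piSchwartzBruhat F ι) :
    tensorEndEquiv A Φ =
      adelicTensorEnd ((A : 𝓢((ι → mixedSpace F), ℂ) →L[ℂ] 𝓢((ι → mixedSpace F), ℂ)) :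
        𝓢((ι → mixedSpace F), ℂ) →ₗ[ℂ] 𝓢((ι → mixedSpace F), ℂ)) LinearMap.id Φ := rfl

omit [DecidableEq ι] in
/-- `(tensorEndEquiv A)⁻¹` acts by `A⁻¹ ⊗ 1`. [cite: Weil1964, Chap. III n° 38 p. 189] -/
@[simp] theorem tensorEndEquiv_symm_apply (Φ : piSchwartzBruhat F ι) :
    (tensorEndEquiv A).symm Φ =
      adelicTensorEnd ((A.symm : 𝓢((ι → mixedSpace F), ℂ) →L[ℂ] 𝓢((ι → mixedSpace F), ℂ)) :
        𝓢((ι → mixedSpace F), ℂ) →ₗ[ℂ] 𝓢((ι → mixedSpace F), ℂ)) LinearMap.id Φ := rfl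

omit [DecidableEq ι] in
/-- on pure tensors: `(A ⊗ 1)(Φ ⊗ f) = A Φ ⊗ f`. [cite: Weil1964, Chap. III n° 38 p. 189] -/
theorem tensorEndEquiv_tmul (Φ : 𝓢((ι → mixedSpace F), ℂ)) (f : FinSB F ι) :
    tensorEndEquiv A (piSchwartzBruhatEquiv F ι (Φ ⊗ₜ f)) = piSchwartzBruhatEquiv F ι (A Φ ⊗ₜ f) := by
  rw [tensorEndEquiv_apply, adelicTensorEnd_apply_tmul, LinearMap.id_apply, ContinuousLinearMap.coe_coe,
    ContinuousLinearEquiv.coe_coe]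

variable {T A} {g : symplecticGroup (polar (adelicForm F ι T))}

/-- **THE CONVERSE DICTIONARY: `(g, A ⊗ 1)` IS AN IMPLEMENTING PAIR** for an archimedean `g` and an archimedean
operator `A` covariant up to Weil's phase. [cite: MoeglinVignerasWaldspurger1987, Chap. 2 II.1 (A); Weil1964, Chap. III n° 38 p. 189] -/
theorem implements_tensorEndEquiv (hg : ∀ k c : ι → FiniteAdeleRing (𝓞 F) F, g.1 (finVec k, finVec c) = (finVec k, finVec c))
    (hA : ∀ (a w : ι → mixedSpace F) (Φ : 𝓢((ι → mixedSpace F), ℂ)),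
      A (archModTrans F ι T a w Φ) =
        weilPhase T g (a, w) • archModTrans F ι T (archAct T g (a, w)).1 (archAct T g (a, w)).2 (A Φ)) :
    Implements (adelicSchrodinger F ι T) (ofSymplectic (polar (adelicForm F ι T)) g) (tensorEndEquiv A) := by
  intro h Ψ
  obtain ⟨z, rfl⟩ := (piSchwartzBruhatEquiv F ι).surjective Ψ
  induction z using TensorProduct.induction_on with
  | zero => simp only [map_zero]
  | add u v hu hv => simp only [map_add, hu, hv]
  | tmul Φ f =>
    obtain ⟨⟨x, y⟩, t⟩ := h
    -- the transformed Heisenberg element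
    have hact : (ofSymplectic (polar (adelicForm F ι T)) g).act (⟨(x, y), t⟩ : AdelicHeisenberg F ι T) =
        (⟨((g.1 (x, y)).1, (g.1 (x, y)).2), t + (ofSymplectic (polar (adelicForm F ι T)) g).f (x, y)⟩ :
          AdelicHeisenberg F ι T) := by
      apply Heisenberg.ext
      · rw [Heisenberg.PseudoSymplectic.act_v, ofSymplectic_σ]
      · rw [Heisenberg.PseudoSymplectic.act_t]
    rw [hact, tensorEndEquiv_tmul, adelicSchrodinger_mk_tmul, adelicSchrodinger_mk_tmul, map_smul, tensorEndEquiv_tmul,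
      hA, (arch_piArch_apply_fst hg), (arch_piArch_apply_snd hg), (arch_piFinite_apply_fst hg), (arch_piFinite_mulVec_apply_snd hg),
      AddChar.map_add_eq_mul, Circle.coe_mul, (arch_addChar_f_apply hg), ← TensorProduct.smul_tmul',
      LinearEquiv.map_smul, smul_smul]

/-- **`(g, A ⊗ 1) ∈ Mp_ψ(W_𝔸)`.** [cite: MoeglinVignerasWaldspurger1987, Chap. 2 II.1 (A)–(B); GelbartRogawski1991, §3.1 p. 454] -/
theorem tensorEnd_mem_adelicMp (hg : ∀ k c : ι → FiniteAdeleRing (𝓞 F) F, g.1 (finVec k, finVec c) = (finVec k, finVec c))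
    (hA : ∀ (a w : ι → mixedSpace F) (Φ : 𝓢((ι → mixedSpace F), ℂ)),
      A (archModTrans F ι T a w Φ) =
        weilPhase T g (a, w) • archModTrans F ι T (archAct T g (a, w)).1 (archAct T g (a, w)).2 (A Φ)) :
    (g, tensorEndEquiv A) ∈ adelicMp F ι T :=
  (mem_MpPsi _ _).2 (implements_tensorEndEquiv hg hA)

/-- **`(g, A ⊗ 1) ∈ Mp_ψ(W_𝔸)ᶜᵒⁿᵗ`** — the metaplectic group of record (`A`, `A⁻¹` continuous on `𝓢`).
[cite: GelbartRogawski1991, §3.1 p. 454; Weil1964, Chap. I n° 11–13] -/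
theorem tensorEnd_mem_adelicMpCont (hg : ∀ k c : ι → FiniteAdeleRing (𝓞 F) F, g.1 (finVec k, finVec c) = (finVec k, finVec c))
    (hA : ∀ (a w : ι → mixedSpace F) (Φ : 𝓢((ι → mixedSpace F), ℂ)),
      A (archModTrans F ι T a w Φ) =
        weilPhase T g (a, w) • archModTrans F ι T (archAct T g (a, w)).1 (archAct T g (a, w)).2 (A Φ)) :
    (⟨(g, tensorEndEquiv A), tensorEnd_mem_adelicMp hg hA⟩ : adelicMp F ι T) ∈ adelicMpCont F ι T :=
  mem_adelicMpCont_of_tensor _ (A : 𝓢((ι → mixedSpace F), ℂ) →L[ℂ] 𝓢((ι → mixedSpace F), ℂ))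
    (A.symm : 𝓢((ι → mixedSpace F), ℂ) →L[ℂ] 𝓢((ι → mixedSpace F), ℂ)) LinearMap.id LinearMap.id
    (fun _ => rfl) (fun _ => rfl)

variable (T A) in
/-- **The element `(g, A ⊗ 1)` of `Mp_ψ(W_𝔸)ᶜᵒⁿᵗ`** attached to an archimedean `g` and a Weil-covariant
archimedean operator `A`. [cite: GelbartRogawski1991, §3.1 p. 454; Weil1964, Chap. III n° 37–38] -/
def archElt (hg : ∀ k c : ι → FiniteAdeleRing (𝓞 F) F, g.1 (finVec k, finVec c) = (finVec k, finVec c))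
    (hA : ∀ (a w : ι → mixedSpace F) (Φ : 𝓢((ι → mixedSpace F), ℂ)),
      A (archModTrans F ι T a w Φ) =
        weilPhase T g (a, w) • archModTrans F ι T (archAct T g (a, w)).1 (archAct T g (a, w)).2 (A Φ)) :
    adelicMpCont F ι T :=
  ⟨⟨(g, tensorEndEquiv A), tensorEnd_mem_adelicMp hg hA⟩, tensorEnd_mem_adelicMpCont hg hA⟩

/-- `proj (archElt) = g`. [cite: GelbartRogawski1991, §3.1 p. 454] -/
@[simp] theorem proj_archElt (hg : ∀ k c : ι → FiniteAdeleRing (𝓞 F) F, g.1 (finVec k, finVec c) = (finVec k, finVec c))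
    (hA : ∀ (a w : ι → mixedSpace F) (Φ : 𝓢((ι → mixedSpace F), ℂ)),
      A (archModTrans F ι T a w Φ) =
        weilPhase T g (a, w) • archModTrans F ι T (archAct T g (a, w)).1 (archAct T g (a, w)).2 (A Φ)) :
    adelicMpCont.proj F ι T (archElt T A hg hA) = g := rfl

/-- `ω (archElt) = A ⊗ 1`. [cite: Weil1964, Chap. III n° 38 p. 189] -/
theorem omega_archElt (hg : ∀ k c : ι → FiniteAdeleRing (𝓞 F) F, g.1 (finVec k, finVec c) = (finVec k, finVec c))
    (hA : ∀ (a w : ι → mixedSpace F) (Φ : 𝓢((ι → mixedSpace F), ℂ)),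
      A (archModTrans F ι T a w Φ) =
        weilPhase T g (a, w) • archModTrans F ι T (archAct T g (a, w)).1 (archAct T g (a, w)).2 (A Φ)) :
    (adelicMpCont.omega F ι T (archElt T A hg hA) : piSchwartzBruhat F ι →ₗ[ℂ] piSchwartzBruhat F ι) =
      adelicTensorEnd ((A : 𝓢((ι → mixedSpace F), ℂ) →L[ℂ] 𝓢((ι → mixedSpace F), ℂ)) :
        𝓢((ι → mixedSpace F), ℂ) →ₗ[ℂ] 𝓢((ι → mixedSpace F), ℂ)) LinearMap.id :=
  rfl

end Implementer

end Literature.NumberTheory.Weil1964
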